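import Mathlib
import Summits.HubbardSuperconductivity.HubbardSuperconductivity.Theses.AposterioriCapRg
import Literature.MathematicalPhysics.QuantumLattice.GrassmannKernels
import Literature.MathematicalPhysics.QuantumLattice.GrassmannParity
import Literature.Analysis.Complex.PickFunctions

/-!
# Sketch — crux-ideate (round 1, ideator k = 2) for `CapRgSymmetricCertificatePinned`
(item stmt-HubbardSuperconductivity-14045, route AposterioriCapRg, rank 2)

First lemmas of the three idea cards of this seat, stated over existing declarations so that the
triagers can see exactly what each line asserts first.  Nothing here is filed as a statement item;
`sorry` marks the lemmas that are NOT proved in this sketch (they are the cards' first obligations).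

* §0 `crux_iff` — the crux by name, unfolded (`Iff.rfl`).
* §1 card `loewner-riccati-channel-sandwich` — the one-step ladder (Bethe–Salpeter) map
  `X ↦ X (1 + R X)⁻¹` is LOEWNER-MONOTONE on the pole-free domain (`ladderStep_mono`), hence a
  two-sided operator sandwich of the Cooper matrix from two-sided brackets of the non-ladder feed
  (`sandwich_step`), hence an enclosure of every Rayleigh quotient / the pairing strength (`rayleigh_sandwich`, proved).
* §2 card `gram-barrier-certificate` — the one-step majorant MAP of Salmhofer–Wieczerkowski 2000 /
  Pedra–Salmhofer 2008 Thm 4.5 typed over the tree's `effAction` / `actionNorm` (`oneStep_majorant`,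
  sorry = the cited theorem), and the BARRIER principle for iterated monotone majorant maps
  (`barrier_certificate`, proved): any super-solution checked step by step bounds the true norms.
* §3 card `os-positivity-envelopes` — Stieltjes/Herglotz envelopes for gapped positive spectral sums
  (`stieltjes_envelope`, proved) and the free half of clause (0c): a Nevanlinna self-energy has field
  strength `≥ 1` (`fieldStrength_ge_one_of_nevanlinna`, proved).
-/

noncomputable section

set_option linter.dupNamespace false

namespace Summit.HubbardSuperconductivity.HubbardSuperconductivity.Cruxes.CapRgSymmetricCertificatePinned.SketchIdeator2

open scoped BigOperators Matrix ComplexOrder InnerProductSpace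
open Literature.MathematicalPhysics.QuantumLattice Summit.HubbardSuperconductivity.HubbardSuperconductivity.Theses.AposterioriCapRg

/-! ### §0 The crux, by name -/

/-- The crux unfolded: density clause at `(U, δ, μ)` and, for every tolerance `Θ = (c₀, w)`, a frame
`K`, a stopping scale `Λ` and a volume threshold `L₀` with the v3 certificate at the literal corner
data `capRgCornerDataT`. -/
theorem crux_iff :
    CapRgSymmetricCertificatePinned ↔
      ∃ U ∈ Set.Icc (2:ℝ) 3, ∃ δ ∈ Set.Icc (1/5:ℝ) (7/20), ∃ μ : ℝ,
        Filter.Tendsto (fun L : ℕ => ((hubbardTorusWith 2 (L + 1) 1 U μ).groundStateFunctional totalNumber).re /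
          ((L + 1 : ℕ) : ℝ) ^ 2) Filter.atTop (nhds (1 - δ)) ∧
        ∀ Θ : SymmetricTolerance, ∃ (K : TrigPolyC4v) (Λ : ℝ) (L₀ : ℕ),
          symmetricRegimeCertificateT U μ capRgCornerDataT Θ K Λ L₀ :=
  Iff.rfl

/-! ### §1 Card `loewner-riccati-channel-sandwich`: Loewner monotonicity of the ladder step -/

section Loewner

variable {n : Type*} [Fintype n] [DecidableEq n]

/-- The one-step ladder (Bethe–Salpeter / BCS-channel) map with single-slice pair bubble `R ≥ 0`:
`Φ_R(X) = X (1 + R X)⁻¹` — the exact resummation of the particle–particle ladder of one RG step; for a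
scalar bubble `R = b·1` it is `x ↦ x/(1 + b x)`, the `cooperLadder` of
`Literature.Barriers.HubbardSuperconductivity.WeakCouplingCeilingNarrow`. -/
def ladderStep (R X : Matrix n n ℂ) : Matrix n n ℂ := X * (1 + R * X)⁻¹

/-- **Loewner monotonicity of the ladder step** (first lemma of the card; the operator version of
`cooperLadder_bubble_mem_Icc`): if the slice bubble `R` is positive semidefinite, `X₁ ≤ X₂` in Loewner
order, and no pole is crossed (`1 + √R Xᵢ √R` positive definite, i.e. the symmetric regime), then
`Φ_R(X₁) ≤ Φ_R(X₂)`.  Proof route: congruence by `√R` and operator-antitonicity of the inverse on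
positive definite matrices (`Φ_R(X) = R^{-1/2}(1 - (1 + √R X √R)⁻¹)R^{-1/2}` for `R > 0`, limit for
`R ≥ 0`); equivalently `IsMatrixMonotoneOn (fun x => x / (1 + b * x)) (Set.Ioi (-1/b))` tensored
with the congruence. NOT proved here. -/
theorem ladderStep_mono (R S X₁ X₂ : Matrix n n ℂ) (hR : R.PosSemidef) (hS : S.PosSemidef)
    (hSR : S * S = R) (h₁ : X₁.IsHermitian) (h₂ : X₂.IsHermitian) (hle : (X₂ - X₁).PosSemidef)
    (hd₁ : (1 + S * X₁ * S).PosDef) (hd₂ : (1 + S * X₂ * S).PosDef) :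
    (ladderStep R X₂ - ladderStep R X₁).PosSemidef := by
  sorry

/-- The scalar shadow, in the tree's matrix-monotone language: `x ↦ x/(1 + b x)` is matrix monotone of
all orders on `(-1/b, ∞)` for `b > 0` (a Pick function: `(1/b)(1 - 1/(1 + b z))` maps the upper
half-plane to itself). NOT proved here (it follows from `isMatrixMonotoneOn_inv_of_neg`-type closure
lemmas of `Literature.Analysis.Complex`). -/
theorem isMatrixMonotoneOn_ladder {b : ℝ} (hb : 0 < b) :
    Literature.Analysis.Complex.IsMatrixMonotoneOn (fun x => x / (1 + b * x)) (Set.Ioi (-1 / b)) := by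
  sorry

/-- **One sandwich step**: a flow step `X' = Φ_R(X) + F` with the non-ladder feed `F` bracketed in
Loewner order, `F⁻ ≤ F ≤ F⁺`, and comparison matrices `X⁻ ≤ X ≤ X⁺` (all inside the pole-free domain)
gives `Φ_R(X⁻) + F⁻ ≤ X' ≤ Φ_R(X⁺) + F⁺`.  Pure consequence of `ladderStep_mono`; iterating it over the
≤ 11.5 dyadic scales of the symmetric flow is the card's ENCLOSURE THEOREM (no interval wrapping:
two point-valued comparison flows). -/
theorem sandwich_step (R S X Xm Xp F Fm Fp : Matrix n n ℂ) (hR : R.PosSemidef) (hS : S.PosSemidef)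
    (hSR : S * S = R) (hX : X.IsHermitian) (hXm : Xm.IsHermitian) (hXp : Xp.IsHermitian)
    (hlo : (X - Xm).PosSemidef) (hhi : (Xp - X).PosSemidef)
    (hFlo : (F - Fm).PosSemidef) (hFhi : (Fp - F).PosSemidef)
    (hdm : (1 + S * Xm * S).PosDef) (hd : (1 + S * X * S).PosDef) (hdp : (1 + S * Xp * S).PosDef) :
    (ladderStep R X + F - (ladderStep R Xm + Fm)).PosSemidef ∧
      (ladderStep R Xp + Fp - (ladderStep R X + F)).PosSemidef := by
  constructor
  · have h1 := ladderStep_mono R S Xm X hR hS hSR hXm hX hlo hdm hd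
    simpa [add_sub_add_comm] using h1.add hFlo
  · have h1 := ladderStep_mono R S X Xp hR hS hSR hX hXp hhi hd hdp
    simpa [add_sub_add_comm] using h1.add hFhi

omit [DecidableEq n] in
/-- **Eigenvalue enclosure from a Loewner sandwich** (Weyl monotonicity, the form the certificate's
window clause (iii′) consumes: `pairingStrength = -λ_min`): if `Xm ≤ X ≤ Xp` then every Rayleigh
quotient of `X` lies between the extreme Rayleigh quotients of `Xm` and `Xp`; stated for the bottom
of the spectrum via quadratic forms. Proved (it is the definition of the Loewner order). -/
theorem rayleigh_sandwich (X Xm Xp : Matrix n n ℂ) (hlo : (X - Xm).PosSemidef) (hhi : (Xp - X).PosSemidef)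
    (v : n → ℂ) :
    (star v ⬝ᵥ (Xm *ᵥ v)).re ≤ (star v ⬝ᵥ (X *ᵥ v)).re ∧ (star v ⬝ᵥ (X *ᵥ v)).re ≤ (star v ⬝ᵥ (Xp *ᵥ v)).re := by
  constructor
  · have h := hlo.dotProduct_mulVec_nonneg v
    rw [Matrix.sub_mulVec, dotProduct_sub] at h
    have h' := (Complex.le_def.1 h).1
    simp only [Complex.zero_re, Complex.sub_re] at h'
    linarith
  · have h := hhi.dotProduct_mulVec_nonneg v
    rw [Matrix.sub_mulVec, dotProduct_sub] at h
    have h' := (Complex.le_def.1 h).1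
    simp only [Complex.zero_re, Complex.sub_re] at h'
    linarith

end Loewner

/-! ### §2 Card `gram-barrier-certificate`: the one-step majorant map and the barrier principle -/

section Gram

variable {Γ : Type*} [Fintype Γ] [LinearOrder Γ]

/-- `C` has a **Gram representation with constant `γ`**: `C X Y = ⟪a X, b Y⟫` in some Hilbert space with
`‖a X‖, ‖b Y‖ ≤ γ` (Salmhofer–Wieczerkowski 2000 (2.6); for Hamiltonian-sliced covariances replace by
Pedra–Salmhofer's determinant bound, Thm 2.4: `δ_C = 2 (∫|σ|)^{1/2}`). -/
def HasGramConst (C : Matrix Γ Γ ℂ) (γ : ℝ) : Prop :=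
  ∃ (E : Type) (_ : NormedAddCommGroup E) (_ : InnerProductSpace ℂ E) (a b : Γ → E),
    (∀ X Y, C X Y = inner ℂ (a X) (b Y)) ∧ (∀ X, ‖a X‖ ≤ γ) ∧ ∀ Y, ‖b Y‖ ≤ γ

/-- The **decay constant** of `C` in Salmhofer's `L¹–L^∞` norm with integration weight `ε`:
`ω_C = max(sup_X ε Σ_Y |C X Y|, sup_Y ε Σ_X |C X Y|)` is at most `ω`. -/
def HasDecayConst (ε : ℝ) (C : Matrix Γ Γ ℂ) (ω : ℝ) : Prop :=
  (∀ X, ε * ∑ Y, ‖C X Y‖ ≤ ω) ∧ ∀ Y, ε * ∑ X, ‖C X Y‖ ≤ ω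

/-- **The one-step majorant map** (Salmhofer–Wieczerkowski 2000 Thm 1 = Pedra–Salmhofer 2008 Thm 4.5,
typed over the tree's `effAction`/`actionNorm`; the card's analytic input, NOT proved here): for an
even interaction `V` with no constant part, Gram constant `γ` and decay constant `ω` of the slice
covariance, and `ω ‖V‖_{h+3γ} < 1`,
`‖effAction C V‖_h ≤ -(1/ω) log (1 - ω ‖V‖_{h+3γ})` where `‖F‖_h = actionNorm (h^·) ε F`.
The only model inputs are the two slice constants `(γ, ω)` — the numbers the card COMPUTES per scale. -/
theorem oneStep_majorant (ε h γ ω : ℝ) (hε : 0 < ε) (hh : 0 ≤ h) (hγ : 0 ≤ γ) (hω : 0 < ω)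
    (C : Matrix Γ Γ ℂ) (hCt : Cᵀ = -C) (hG : HasGramConst C γ) (hD : HasDecayConst ε C ω)
    (V : GrassmannAlgebra ℂ Γ) (hV : V ∈ GrassmannAlgebra.evenOdd ℂ 0) (hV0 : constPart ℂ V = 0)
    (hsmall : ω * actionNorm (fun m => (h + 3 * γ) ^ m) ε V < 1) :
    actionNorm (fun m => h ^ m) ε (effAction ℂ C V) ≤
      -(1 / ω) * Real.log (1 - ω * actionNorm (fun m => (h + 3 * γ) ^ m) ε V) := by
  sorry

/-- **Barrier principle for iterated monotone majorant maps** (the certificate format of the card):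
if the true per-degree norms `x j : ι → ℝ` of the flow obey `x (j+1) ≤ Φ j (x j)` componentwise with
each `Φ j` monotone, then ANY componentwise super-solution `B` (`Φ j (B j) ≤ B (j+1)`, `x 0 ≤ B 0`) —
e.g. one found by the computer and checked by interval arithmetic at finitely many scales — bounds the
flow: `x j ≤ B j` for all `j`.  Proved (induction); monotonicity is what removes the need for any
contraction / fixed-point argument in the analytic tail of the CAP. -/
theorem barrier_certificate {ι : Type*} (Φ : ℕ → (ι → ℝ) → (ι → ℝ)) (hΦ : ∀ j, Monotone (Φ j))
    (x B : ℕ → ι → ℝ) (hx : ∀ j, x (j + 1) ≤ Φ j (x j)) (hB : ∀ j, Φ j (B j) ≤ B (j + 1))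
    (h0 : x 0 ≤ B 0) : ∀ j, x j ≤ B j := by
  intro j
  induction j with
  | zero => exact h0
  | succ j ih => exact (hx j).trans ((hΦ j ih).trans (hB j))

/-- The scalar one-step majorant of `oneStep_majorant` as a function of the input norm `v` at fixed
`(ω)`: `v ↦ -(1/ω) log(1 - ω v)`, monotone on `[0, 1/ω)` — so `barrier_certificate` applies to the
scale-indexed family of these maps (with the degree bookkeeping `h_j = h_{j+1} + 3γ_{j+1}`). Proved. -/
theorem oneStep_scalar_monotone {ω : ℝ} (hω : 0 < ω) :
    MonotoneOn (fun v : ℝ => -(1 / ω) * Real.log (1 - ω * v)) (Set.Ico 0 (1 / ω)) := by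
  intro a ha b hb hab
  have ha' : ω * a < 1 := by rw [← lt_div_iff₀' hω]; exact ha.2
  have hb' : ω * b < 1 := by rw [← lt_div_iff₀' hω]; exact hb.2
  have hlog : Real.log (1 - ω * b) ≤ Real.log (1 - ω * a) :=
    Real.log_le_log (by linarith) (by nlinarith)
  have : 0 < 1 / ω := by positivity
  nlinarith

end Gram

/-! ### §3 Card `os-positivity-envelopes`: Stieltjes envelopes and the free half of clause (0c) -/

section Positivity

/-- A **gapped atomic Stieltjes sum** in the Matsubara variable `s = ν²`:
`F(s) = Σ_j w_j / (E_j² + s)`, `w_j ≥ 0`, `E_j² ≥ m²` — the form every bosonic channel propagator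
(pair, spin, charge susceptibility) of a finite-volume HAMILTONIAN takes by the spectral theorem, with
`m` the gap of the IR-cutoff Hamiltonian `H_{>Λ}` (Hamiltonian slicing, Pedra–Salmhofer 2008 §4). -/
def stieltjesAtom {J : Type*} [Fintype J] (w E : J → ℝ) (s : ℝ) : ℝ := ∑ j, w j / (E j ^ 2 + s)

/-- **Two-sample Stieltjes envelope** (first lemma of the card, proved): with weights `w ≥ 0`, gap
`m² ≤ E_j²`, `0 < m`, and `0 ≤ s₁ ≤ s`, the value `F(s)` between two Matsubara samples is enclosed
WITHOUT any derivative information: `(m² + s₁)/(m² + s) · F(s₁) ≤ F(s) ≤ F(s₁)` (and symmetrically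
from the right sample).  The relative width of the envelope is `(s - s₁)/(m² + s)`: finitely many
certified samples on a geometric grid in `s = ν²` enclose the whole channel propagator to any
relative precision, the gap `m` of the IR-cutoff Hamiltonian `H_{>Λ}` being the only input. -/
theorem stieltjes_envelope {J : Type*} [Fintype J] (w E : J → ℝ) (m s₁ s : ℝ) (hw : ∀ j, 0 ≤ w j)
    (hm : 0 < m) (hE : ∀ j, m ^ 2 ≤ E j ^ 2) (hs₁ : 0 ≤ s₁) (hs : s₁ ≤ s) :
    stieltjesAtom w E s ≤ stieltjesAtom w E s₁ ∧
      (m ^ 2 + s₁) / (m ^ 2 + s) * stieltjesAtom w E s₁ ≤ stieltjesAtom w E s := by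
  have hm2 : 0 < m ^ 2 := by positivity
  constructor
  · unfold stieltjesAtom
    refine Finset.sum_le_sum fun j _ => ?_
    have hEj : 0 < E j ^ 2 + s₁ := by linarith [hE j]
    exact div_le_div_of_nonneg_left (hw j) hEj (by linarith)
  · unfold stieltjesAtom
    rw [Finset.mul_sum]
    refine Finset.sum_le_sum fun j _ => ?_
    have hEj₁ : 0 < E j ^ 2 + s₁ := by linarith [hE j]
    have hEj : 0 < E j ^ 2 + s := by linarith [hE j]
    have hms : 0 < m ^ 2 + s := by linarith
    rw [div_mul_div_comm, div_le_div_iff₀ (mul_pos hms hEj₁) hEj]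
    have hkey : (m ^ 2 + s₁) * (E j ^ 2 + s) ≤ (m ^ 2 + s) * (E j ^ 2 + s₁) := by
      nlinarith [hE j, mul_le_mul_of_nonneg_left (hE j) (sub_nonneg.2 hs)]
    calc (m ^ 2 + s₁) * w j * (E j ^ 2 + s) = w j * ((m ^ 2 + s₁) * (E j ^ 2 + s)) := by ring
      _ ≤ w j * ((m ^ 2 + s) * (E j ^ 2 + s₁)) := mul_le_mul_of_nonneg_left hkey (hw j)
      _ = w j * ((m ^ 2 + s) * (E j ^ 2 + s₁)) := rfl

/-- An **atomic Nevanlinna (spectral) self-energy** on the Matsubara axis: `Σ(iω) = Σ_j w_j/(iω - ν_j)`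
with `w_j ≥ 0` — the form the self-energy of any finite-volume Hamiltonian takes (Källén–Lehmann). -/
def nevanlinnaAtom {J : Type*} [Fintype J] (w ν : J → ℝ) (ω : ℝ) : ℂ :=
  ∑ j, (w j : ℂ) / ((ω : ℂ) * Complex.I - ν j)

/-- **The free half of clause (0c)** (proved): for a Nevanlinna self-energy the field strength defined
as in `SymmetricRegimeFunctionals.fieldStrengthSpin` — `z = 1 - (Im Σ(iω₀) - Im Σ(-iω₀))/(2ω₀)` —
satisfies `z = 1 + Σ_j w_j/(ω₀² + ν_j²) ≥ 1`; in particular `z ≥ ζ` for every floor `ζ ≤ 1`.  (The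
upper half `z ≤ 1/ζ` is a genuine spectral-weight bound, the card's second obligation.) -/
theorem fieldStrength_ge_one_of_nevanlinna {J : Type*} [Fintype J] (w ν : J → ℝ) (hw : ∀ j, 0 ≤ w j)
    (ω₀ : ℝ) (hω : 0 < ω₀) :
    1 ≤ 1 - ((nevanlinnaAtom w ν ω₀).im - (nevanlinnaAtom w ν (-ω₀)).im) / (2 * ω₀) := by
  have key : ∀ ω : ℝ, (nevanlinnaAtom w ν ω).im = -(ω * ∑ j, w j / (ω ^ 2 + ν j ^ 2)) := by
    intro ω
    unfold nevanlinnaAtom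
    rw [Complex.im_sum, Finset.mul_sum, ← Finset.sum_neg_distrib]
    refine Finset.sum_congr rfl fun j _ => ?_
    have hre : ((ω : ℂ) * Complex.I - (ν j : ℂ)).re = -ν j := by simp
    have him : ((ω : ℂ) * Complex.I - (ν j : ℂ)).im = ω := by simp
    rw [Complex.div_im, Complex.normSq_apply, hre, him, Complex.ofReal_re, Complex.ofReal_im]
    ring
  have hsym : ∑ j, w j / ((-ω₀) ^ 2 + ν j ^ 2) = ∑ j, w j / (ω₀ ^ 2 + ν j ^ 2) := by simp
  have hS : 0 ≤ ∑ j, w j / (ω₀ ^ 2 + ν j ^ 2) :=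
    Finset.sum_nonneg fun j _ => div_nonneg (hw j) (by positivity)
  rw [key, key, hsym]
  have h2 : (-(ω₀ * ∑ j, w j / (ω₀ ^ 2 + ν j ^ 2)) - -(-ω₀ * ∑ j, w j / (ω₀ ^ 2 + ν j ^ 2))) / (2 * ω₀) =
      -∑ j, w j / (ω₀ ^ 2 + ν j ^ 2) := by
    field_simp
    ring
  rw [h2]
  linarith

end Positivity

end Summit.HubbardSuperconductivity.HubbardSuperconductivity.Cruxes.CapRgSymmetricCertificatePinned.SketchIdeator2
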